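import Summits.FinalStateConjecture.FinalStateConjecture.Theorems.EIHFluxBalanceInertialRecessionChargeKinematicsBasic

/-!
# Route EIHFluxBalance — `InertialRecession`, line `old-light-leaves-the-cone`: charge kinematics,
# III (the linearly isolated hole)

Helper file for the crux `stmt-FinalStateConjecture-10166`
(`Summit.FinalStateConjecture.FinalStateConjecture.Theses.EIHFluxBalance.InertialRecession`), second line
lead, endgame stub `stub_expandingChargeKinematics` (S4: abstract quasi-conserved window charges with the
slack-form window law and the single-hole identification ⇒ Cesàro velocities of the painted centres).

III — THE LINEARLY ISOLATED HOLE: a hole all of whose partners recede linearly (`≥ μ₀ t`) has a convergent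
painted velocity and the Cesàro velocity `ξᵢ(t)/t → Vᵢ` (`tendsto_of_linearly_isolated`): the anchored
window `(ξᵢ(s), c₀ s)` is admissible and `2`-Lipschitz for late `s`, its budget `C∫(R⁻² + R^{-7/4}) + η(t₁)`
tends to `0`, so the charge is Cauchy with slack; identification transfers the limits to `Mᵢγᵢ(1, vᵢ)` and
`γᵢ ≥ 1` recovers `vᵢ`. This is the `N = 1` case of the endgame and the terminal step for every top-level
linear cluster consisting of one hole.

Every statement is Mathlib-only real analysis over the stub's verbatim hypotheses ([folklore]); the abstract
charge `P` is arbitrary (adversarial), constrained only by the window law and the identification.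
-/

set_option linter.dupNamespace false

noncomputable section

open Filter Set Metric Real
open scoped Topology

namespace Summit.FinalStateConjecture.FinalStateConjecture.Theorems.ChargeKinematics

open Literature.Geometry.Lorentzian

/-! ## The linearly isolated hole: window charge Cauchy at scale `t` ⇒ velocity and Cesàro limits -/

section Isolated

open MeasureTheory intervalIntegral

/-- Interval integrability of the window budget integrand `((c s)²)⁻¹ + ((c s)^{7/4})⁻¹` on
`[t₁, t₂] ⊆ (0, ∞)`. [folklore] -/
theorem intervalIntegrable_budget {c t₁ t₂ : ℝ} (hc : 0 < c) (ht₁ : 0 < t₁) (h : t₁ ≤ t₂) :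
    IntervalIntegrable (fun s : ℝ ↦ ((c * s) ^ 2)⁻¹) volume t₁ t₂ ∧
      IntervalIntegrable (fun s : ℝ ↦ ((c * s) ^ (7 / 4 : ℝ))⁻¹) volume t₁ t₂ := by
  have hpos : ∀ s ∈ Set.uIcc t₁ t₂, 0 < c * s := fun s hs ↦ by
    rw [Set.uIcc_of_le h] at hs
    exact mul_pos hc (ht₁.trans_le hs.1)
  have hcs : ContinuousOn (fun s : ℝ ↦ c * s) (Set.uIcc t₁ t₂) :=
    (continuous_const.mul continuous_id).continuousOn
  constructor
  · refine ContinuousOn.intervalIntegrable ?_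
    exact (hcs.pow 2).inv₀ fun s hs ↦ (pow_pos (hpos s hs) 2).ne'
  · refine ContinuousOn.intervalIntegrable ?_
    refine (hcs.rpow_const fun s hs ↦ Or.inr (by norm_num)).inv₀ fun s hs ↦ ?_
    exact (Real.rpow_pos_of_pos (hpos s hs) _).ne'

/-- The window budget along `R = c s` is small uniformly in the endpoint: for `0 < c ≤ 1`… in fact
for every `0 < c`, `0 < t₁ ≤ t₂`,
`∫_{t₁}^{t₂} ((c s)²)⁻¹ + ((c s)^{7/4})⁻¹ ≤ (c² t₁)⁻¹ + (4/3) c^{-7/4} t₁^{-3/4}`. [folklore] -/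
theorem integral_budget_le {c t₁ t₂ : ℝ} (hc : 0 < c) (ht₁ : 0 < t₁) (h : t₁ ≤ t₂) :
    ∫ s in t₁..t₂, (((c * s) ^ 2)⁻¹ + ((c * s) ^ (7 / 4 : ℝ))⁻¹) ≤
      (c ^ 2 * t₁)⁻¹ + 4 / 3 * c ^ (-(7 / 4) : ℝ) * t₁ ^ (-(3 / 4) : ℝ) := by
  obtain ⟨h1, h2⟩ := intervalIntegrable_budget hc ht₁ h
  rw [intervalIntegral.integral_add h1 h2]
  exact add_le_add (integral_inv_sq_mul_le hc ht₁ h) (integral_inv_rpow_mul_le hc ht₁ h)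

/-- The budget bound tends to `0` as `t₁ → ∞`. [folklore] -/
theorem tendsto_budget_bound {c : ℝ} (hc : 0 < c) :
    Tendsto (fun t₁ : ℝ ↦ (c ^ 2 * t₁)⁻¹ + 4 / 3 * c ^ (-(7 / 4) : ℝ) * t₁ ^ (-(3 / 4) : ℝ))
      atTop (𝓝 0) := by
  have h1 : Tendsto (fun t₁ : ℝ ↦ (c ^ 2 * t₁)⁻¹) atTop (𝓝 0) :=
    tendsto_inv_atTop_zero.comp (tendsto_id.const_mul_atTop (by positivity))
  have h2 : Tendsto (fun t₁ : ℝ ↦ 4 / 3 * c ^ (-(7 / 4) : ℝ) * t₁ ^ (-(3 / 4) : ℝ)) atTop (𝓝 0) := by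
    have := (tendsto_rpow_neg_atTop (by norm_num : (0 : ℝ) < 3 / 4)).const_mul
      (4 / 3 * c ^ (-(7 / 4) : ℝ))
    rw [mul_zero] at this
    exact this
  simpa using h1.add h2

/-- A vector of `E3` with prescribed coordinates. [folklore] -/
theorem exists_E3_of_coord (a : Fin 3 → ℝ) : ∃ p : E3, ∀ k, p k = a k :=
  ⟨(EuclideanSpace.equiv (Fin 3) ℝ).symm a, fun k ↦ by simp⟩

/-- **THE LINEARLY ISOLATED HOLE** (the `N = 1` mechanism of the endgame, valid inside any `N`):
under the kinematic clauses of `stub_expandingChargeKinematics` — centres in the cone `κ²t`, slaved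
to eventually subluminal velocities, an abstract charge `P` obeying the WINDOW LAW (slack form) and the
single-hole IDENTIFICATION — a hole `i` whose every partner recedes LINEARLY (`μ₀ t ≤ ‖ξᵢ − ξⱼ‖`
eventually) has a convergent painted velocity `vᵢ(t) → Vᵢ` and the Cesàro velocity `ξᵢ(t)/t → Vᵢ`.
Proof: the anchored window `c = ξᵢ(s)`, `R = c₀ s`, `c₀ = min((κ−κ²)/2, μ₀/3, 1)`, is `1/2`-admissible and
`2`-Lipschitz for late `s`; its budget `C∫(R⁻² + R^{-7/4}) + η(t₁) → 0`, so the four components of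
`P` along it are Cauchy with slack and converge; identification (error `ζ + C/R → 0`) transfers the limits
to `Mᵢγᵢ` and `Mᵢγᵢvᵢ`; `γᵢ ≥ 1` recovers `vᵢ`; slaving gives the Cesàro limit. [folklore] -/
theorem tendsto_of_linearly_isolated {N : ℕ} {M : Fin N → ℝ} {ξ v : Fin N → ℝ → E3} {κ : ℝ}
    {P : ℝ → E3 → ℝ → Fin 4 → ℝ}
    (hM : ∀ i, 0 < M i) (hκ0 : 0 < κ) (hκ1 : κ < 1)
    (hξ : ∀ i, ContDiff ℝ ((⊤ : ℕ∞) : WithTop ℕ∞) (ξ i))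
    (hcone : ∀ i, ∀ᶠ t in atTop, ‖ξ i t‖ ≤ κ ^ 2 * t)
    (hk : ∃ k : ℝ, 0 ≤ k ∧ k < 1 ∧ ∀ i, ∀ᶠ t in atTop, ‖v i t‖ ≤ k)
    (hslave : ∀ i, Tendsto (fun t ↦ deriv (ξ i) t - v i t) atTop (𝓝 0))
    (hW : ∀ δ : ℝ, 0 < δ → δ < 1 → ∃ (C R₀ T : ℝ) (η : ℝ → ℝ), Tendsto η atTop (𝓝 0) ∧ ∀ (t₁ t₂ : ℝ) (c : ℝ → E3) (R : ℝ → ℝ), T ≤ t₁ → t₁ ≤ t₂ → (∀ s ∈ Set.Icc t₁ t₂, ∀ s' ∈ Set.Icc t₁ t₂, ‖c s - c s'‖ ≤ 2 * |s - s'| ∧ |R s - R s'| ≤ 2 * |s - s'|) → (∀ s ∈ Set.Icc t₁ t₂, (R₀ ≤ R s ∧ ‖c s‖ + R s ≤ (κ + κ ^ 2) / 2 * s ∧ ∀ j, ‖ξ j s - c s‖ ≤ (1 - δ) * R s ∨ (1 + δ) * R s ≤ ‖ξ j s - c s‖)) → ∀ μ : Fin 4, |P t₂ (c t₂) (R t₂)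 μ - P t₁ (c t₁) (R t₁) μ| ≤ C * (∫ s in t₁..t₂, ((R s) ^ 2)⁻¹ + ((R s) ^ (7 / 4 : ℝ))⁻¹) + η t₁)
    (hI : ∃ (C R₀ T : ℝ) (ζ : ℝ → ℝ), Tendsto ζ atTop (𝓝 0) ∧ (∀ (t : ℝ) (i : Fin N) (R : ℝ), T ≤ t → R₀ ≤ R → ‖ξ i t‖ + R ≤ (κ + κ ^ 2) / 2 * t → (∀ j, j ≠ i → 3 * R ≤ ‖ξ i t - ξ j t‖) → |P t (ξ i t) R 0 - M i * (√(1 - ‖v i t‖ ^ 2))⁻¹| ≤ ζ t + C / R ∧ ∀ k : Fin 3, |P t (ξ i t) R k.succ - M i * (√(1 - ‖v i t‖ ^ 2))⁻¹ * v i t k| ≤ ζ t + C / R) ∧ (∀ (t : ℝ) (c : E3) (R : ℝ) (A : Finset (Fin N)) (ρ : Fin N → ℝ), T ≤ t → R₀ ≤ R → ‖c‖ + R ≤ (κ + κ ^ 2) / 2 * t → (∀ j ∈ A, ‖ξ j t - c‖ ≤ R / 2) → (∀ j ∉ A, 2 * R ≤ ‖ξ j t - c‖) → (∀ j ∈ A,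 R₀ ≤ ρ j ∧ ρ j ≤ R / 4 ∧ ∀ j', j' ≠ j → 3 * ρ j ≤ ‖ξ j t - ξ j' t‖) → ∀ μ : Fin 4, |P t c R μ - ∑ j ∈ A, P t (ξ j t) (ρ j) μ| ≤ C * (R⁻¹ + ∑ j ∈ A, (ρ j)⁻¹) + ζ t))
    {i : Fin N} {μ₀ : ℝ} (hμ₀ : 0 < μ₀)
    (hiso : ∀ j, j ≠ i → ∀ᶠ t in atTop, μ₀ * t ≤ ‖ξ i t - ξ j t‖) :
    ∃ V : E3, Tendsto (v i) atTop (𝓝 V) ∧ Tendsto (fun t : ℝ ↦ t⁻¹ • ξ i t) atTop (𝓝 V) := by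
  -- the data of the window law at `δ = 1/2` and of the identification
  obtain ⟨C, R₀, T, η, hη, hlaw⟩ := hW (1 / 2) (by norm_num) (by norm_num)
  obtain ⟨C', R₀', T', ζ, hζ, hid, -⟩ := hI
  obtain ⟨k, hk0, hk1, hvk⟩ := hk
  -- the radius rate `c₀`
  set c₀ : ℝ := min (min ((κ - κ ^ 2) / 2) (μ₀ / 3)) 1 with hc₀
  have hκκ : 0 < κ - κ ^ 2 := by nlinarith
  have hc₀pos : 0 < c₀ := lt_min (lt_min (by linarith) (by linarith)) one_pos
  have hc₀κ : c₀ ≤ (κ - κ ^ 2) / 2 := (min_le_left _ _).trans (min_le_left _ _)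
  have hc₀μ : c₀ ≤ μ₀ / 3 := (min_le_left _ _).trans (min_le_right _ _)
  have hc₀1 : c₀ ≤ 1 := min_le_right _ _
  -- differentiability and the eventual `2`-Lipschitz bound of `ξ i`
  have hdiff : Differentiable ℝ (ξ i) := (contDiff_infty_iff_deriv.mp (hξ i)).1
  obtain ⟨TL, hTL⟩ := exists_forall_norm_sub_le_two_mul hdiff (hslave i) hk1.le (hvk i)
  -- one late threshold `T₀` after which every pointwise clause holds
  have hiso' : ∀ᶠ t in atTop, ∀ j, j ≠ i → μ₀ * t ≤ ‖ξ i t - ξ j t‖ := by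
    have : ∀ j, ∀ᶠ t in atTop, j ≠ i → μ₀ * t ≤ ‖ξ i t - ξ j t‖ := fun j ↦ by
      by_cases hj : j = i
      · exact Eventually.of_forall fun t h ↦ (h hj).elim
      · exact (hiso j hj).mono fun t ht _ ↦ ht
    exact eventually_all.mpr this
  have hR₀ : ∀ᶠ t : ℝ in atTop, R₀ ≤ c₀ * t :=
    (tendsto_id.const_mul_atTop hc₀pos).eventually_ge_atTop R₀
  have hR₀' : ∀ᶠ t : ℝ in atTop, R₀' ≤ c₀ * t :=
    (tendsto_id.const_mul_atTop hc₀pos).eventually_ge_atTop R₀'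
  obtain ⟨T₀, hT₀⟩ := eventually_atTop.mp ((hcone i).and (hiso'.and ((hvk i).and (hR₀.and
    (hR₀'.and ((eventually_ge_atTop T).and ((eventually_ge_atTop T').and
      ((eventually_ge_atTop TL).and (eventually_ge_atTop (1 : ℝ))))))))))
  -- names for the clauses after `T₀`
  have hcl : ∀ t, T₀ ≤ t → ‖ξ i t‖ ≤ κ ^ 2 * t ∧ (∀ j, j ≠ i → μ₀ * t ≤ ‖ξ i t - ξ j t‖) ∧
      ‖v i t‖ ≤ k ∧ R₀ ≤ c₀ * t ∧ R₀' ≤ c₀ * t ∧ T ≤ t ∧ T' ≤ t ∧ TL ≤ t ∧ 1 ≤ t :=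
    fun t ht ↦ hT₀ t ht
  -- the charge components along the anchored window path
  set g : Fin 4 → ℝ → ℝ := fun μ t ↦ P t (ξ i t) (c₀ * t) μ with hg
  -- (1) the window law along the path, for `T₀ ≤ t₁ ≤ t₂`
  have hpath : ∀ t₁ t₂, T₀ ≤ t₁ → t₁ ≤ t₂ → ∀ μ, |g μ t₂ - g μ t₁| ≤
      |C| * ((c₀ ^ 2 * t₁)⁻¹ + 4 / 3 * c₀ ^ (-(7 / 4) : ℝ) * t₁ ^ (-(3 / 4) : ℝ)) + η t₁ := by
    intro t₁ t₂ ht₁ h12 μ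
    obtain ⟨-, -, -, -, -, hT, -, hTL1, h1⟩ := hcl t₁ ht₁
    have ht₁pos : 0 < t₁ := by linarith
    have key := hlaw t₁ t₂ (fun s ↦ ξ i s) (fun s ↦ c₀ * s) hT h12 ?_ ?_ μ
    · refine key.trans (add_le_add ?_ le_rfl)
      have hint := integral_budget_le hc₀pos ht₁pos h12
      have hnn : 0 ≤ ∫ s in t₁..t₂, (((c₀ * s) ^ 2)⁻¹ + ((c₀ * s) ^ (7 / 4 : ℝ))⁻¹) := by
        apply intervalIntegral.integral_nonneg h12
        intro s hs
        have hs0 : 0 < c₀ * s := mul_pos hc₀pos (ht₁pos.trans_le hs.1)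
        positivity
      calc C * ∫ s in t₁..t₂, (((c₀ * s) ^ 2)⁻¹ + ((c₀ * s) ^ (7 / 4 : ℝ))⁻¹)
          ≤ |C| * ∫ s in t₁..t₂, (((c₀ * s) ^ 2)⁻¹ + ((c₀ * s) ^ (7 / 4 : ℝ))⁻¹) :=
            mul_le_mul_of_nonneg_right (le_abs_self C) hnn
        _ ≤ |C| * ((c₀ ^ 2 * t₁)⁻¹ + 4 / 3 * c₀ ^ (-(7 / 4) : ℝ) * t₁ ^ (-(3 / 4) : ℝ)) :=
            mul_le_mul_of_nonneg_left hint (abs_nonneg C)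
    · -- `2`-Lipschitz centre and radius
      intro s hs s' hs'
      refine ⟨hTL s s' (hTL1.trans hs.1) (hTL1.trans hs'.1), ?_⟩
      rw [← mul_sub, abs_mul, abs_of_pos hc₀pos]
      exact mul_le_mul_of_nonneg_right (hc₀1.trans (by norm_num)) (abs_nonneg _)
    · -- admissible `1/2`-windows along the path
      intro s hs
      obtain ⟨hcone_s, hiso_s, -, hR₀s, -⟩ := hcl s (ht₁.trans hs.1)
      have hs0 : 0 ≤ s := by linarith [hs.1]
      refine ⟨hR₀s, ?_, fun j ↦ ?_⟩
      · have : c₀ * s ≤ (κ - κ ^ 2) / 2 * s := mul_le_mul_of_nonneg_right hc₀κ hs0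
        nlinarith
      · by_cases hj : j = i
        · left
          subst hj
          rw [sub_self, norm_zero]
          positivity
        · right
          have h3 : μ₀ * s ≤ ‖ξ i s - ξ j s‖ := hiso_s j hj
          rw [norm_sub_rev]
          have : (1 + 1 / 2) * (c₀ * s) ≤ μ₀ * s := by nlinarith
          linarith
  -- (2) the four components converge
  have hbound : Tendsto (fun t₁ : ℝ ↦ |C| * ((c₀ ^ 2 * t₁)⁻¹ +
      4 / 3 * c₀ ^ (-(7 / 4) : ℝ) * t₁ ^ (-(3 / 4) : ℝ)) + η t₁) atTop (𝓝 0) := by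
    have := ((tendsto_budget_bound hc₀pos).const_mul |C|).add hη
    simpa using this
  have hconv : ∀ μ, ∃ L, Tendsto (g μ) atTop (𝓝 L) := by
    intro μ
    apply exists_tendsto_of_abs_sub_le
    intro ε hε
    have hev : ∀ᶠ t₁ in atTop, |C| * ((c₀ ^ 2 * t₁)⁻¹ +
        4 / 3 * c₀ ^ (-(7 / 4) : ℝ) * t₁ ^ (-(3 / 4) : ℝ)) + η t₁ < ε :=
      hbound.eventually (gt_mem_nhds hε)
    obtain ⟨T₁, hT₁⟩ := eventually_atTop.mp (hev.and (eventually_ge_atTop T₀))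
    refine ⟨T₁, fun t₁ t₂ ht₁ h12 ↦ ?_⟩
    obtain ⟨hlt, hT₀t⟩ := hT₁ t₁ ht₁
    exact ((hpath t₁ t₂ hT₀t h12 μ).trans hlt.le)
  choose L hL using hconv
  -- (3) identification along the path: the error `ζ + C'/(c₀ t) → 0`
  have herr : Tendsto (fun t ↦ ζ t + C' / (c₀ * t)) atTop (𝓝 0) := by
    have h2 : Tendsto (fun t : ℝ ↦ C' / (c₀ * t)) atTop (𝓝 0) := by
      have := tendsto_inv_atTop_zero.comp (tendsto_id.const_mul_atTop hc₀pos)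
      have := this.const_mul C'
      rw [mul_zero] at this
      refine this.congr fun t ↦ ?_
      simp [div_eq_mul_inv]
    simpa using hζ.add h2
  have hidt : ∀ t, T₀ ≤ t →
      |g 0 t - M i * (√(1 - ‖v i t‖ ^ 2))⁻¹| ≤ ζ t + C' / (c₀ * t) ∧
        ∀ k' : Fin 3, |g k'.succ t - M i * (√(1 - ‖v i t‖ ^ 2))⁻¹ * v i t k'| ≤
          ζ t + C' / (c₀ * t) := by
    intro t ht
    obtain ⟨hcone_t, hiso_t, -, -, hR₀'t, -, hT't, -, h1⟩ := hcl t ht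
    have ht0 : 0 ≤ t := by linarith
    refine hid t i (c₀ * t) hT't hR₀'t ?_ fun j hj ↦ ?_
    · have : c₀ * t ≤ (κ - κ ^ 2) / 2 * t := mul_le_mul_of_nonneg_right hc₀κ ht0
      nlinarith
    · have h3 : μ₀ * t ≤ ‖ξ i t - ξ j t‖ := hiso_t j hj
      nlinarith
  -- energy component: `M i * γ → L 0`, hence `γ → L 0 / M i`
  set γ : ℝ → ℝ := fun t ↦ (√(1 - ‖v i t‖ ^ 2))⁻¹ with hγdef
  have hγlim : Tendsto (fun t ↦ M i * γ t) atTop (𝓝 (L 0)) := by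
    have hdiff0 : Tendsto (fun t ↦ g 0 t - M i * γ t) atTop (𝓝 0) := by
      refine squeeze_zero_norm' ?_ herr
      filter_upwards [eventually_ge_atTop T₀] with t ht
      rw [Real.norm_eq_abs]
      exact (hidt t ht).1
    have := (hL 0).sub hdiff0
    simpa using this
  have hγlim' : Tendsto γ atTop (𝓝 ((M i)⁻¹ * L 0)) := by
    have := hγlim.const_mul (M i)⁻¹
    refine this.congr fun t ↦ ?_
    rw [← mul_assoc, inv_mul_cancel₀ (hM i).ne', one_mul]
  -- momentum components: `M i * γ * v_k → L (k+1)`, hence `γ * v_k → L(k+1) / M i`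
  have hplim : ∀ k' : Fin 3, Tendsto (fun t ↦ γ t * v i t k') atTop (𝓝 ((M i)⁻¹ * L k'.succ)) := by
    intro k'
    have hdiffk : Tendsto (fun t ↦ g k'.succ t - M i * γ t * v i t k') atTop (𝓝 0) := by
      refine squeeze_zero_norm' ?_ herr
      filter_upwards [eventually_ge_atTop T₀] with t ht
      rw [Real.norm_eq_abs]
      exact (hidt t ht).2 k'
    have h1 := (hL k'.succ).sub hdiffk
    simp only [sub_sub_cancel, sub_zero] at h1
    have h2 := h1.const_mul (M i)⁻¹
    refine h2.congr fun t ↦ ?_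
    rw [← mul_assoc, ← mul_assoc, inv_mul_cancel₀ (hM i).ne', one_mul]
  -- assemble the proper velocity `γ • v → p`
  obtain ⟨p, hp⟩ := exists_E3_of_coord fun k' ↦ (M i)⁻¹ * L k'.succ
  have hpv : Tendsto (fun t ↦ γ t • v i t) atTop (𝓝 p) := by
    refine tendsto_of_forall_coord fun k' ↦ ?_
    rw [hp k']
    refine (hplim k').congr fun t ↦ ?_
    simp [smul_eq_mul]
  -- `γ ≥ 1` eventually, so its limit `E` is `≥ 1`, in particular nonzero
  have hγge : ∀ᶠ t in atTop, 1 ≤ γ t := by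
    filter_upwards [hvk i] with t ht
    exact one_le_gammaFactor (ht.trans_lt hk1)
  have hE1 : 1 ≤ (M i)⁻¹ * L 0 := ge_of_tendsto hγlim' hγge
  have hE0 : (M i)⁻¹ * L 0 ≠ 0 := by positivity
  have hγne : ∀ᶠ t in atTop, γ t ≠ 0 := hγge.mono fun t ht ↦ by positivity
  -- the velocity converges …
  have hv : Tendsto (v i) atTop (𝓝 (((M i)⁻¹ * L 0)⁻¹ • p)) :=
    tendsto_of_tendsto_gamma_smul hγlim' hpv hE0 hγne
  -- … and so does the Cesàro mean of the centre
  exact ⟨_, hv, cesaro_of_slaved hdiff (hslave i) hv⟩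

end Isolated

end Summit.FinalStateConjecture.FinalStateConjecture.Theorems.ChargeKinematics

namespace Summit.FinalStateConjecture.FinalStateConjecture.Theorems

/-- REGISTERED STUB `tendsto_of_linearly_isolated` of the crux item stmt-FinalStateConjecture-10166 (second line lead, line
`old-light-leaves-the-cone`, S4 helper series): the registered one-line signature verbatim, discharged by
`ChargeKinematics.tendsto_of_linearly_isolated`. [folklore] -/
theorem tendsto_of_linearly_isolated : open Literature.Geometry.Lorentzian Filter Topology MeasureTheory intervalIntegral in ∀ {N : ℕ} {M : Fin N → ℝ} {ξ v : Fin N → ℝ → E3} {κ : ℝ} {P : ℝ → E3 → ℝ → Fin 4 → ℝ} (hM : ∀ i, 0 < M i) (hκ0 : 0 < κ) (hκ1 : κ < 1) (hξ : ∀ i, ContDiff ℝ ((⊤ : ℕ∞) : WithTop ℕ∞) (ξ i)) (hcone : ∀ i, ∀ᶠ t in atTop, ‖ξ i t‖ ≤ κ ^ 2 * t) (hk : ∃ k : ℝ, 0 ≤ k ∧ k < 1 ∧ ∀ i, ∀ᶠ t in atTop, ‖v i t‖ ≤ k) (hslave : ∀ i, Tendsto (fun t ↦ deriv (ξ i) t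 - v i t) atTop (𝓝 0)) (hW : ∀ δ : ℝ, 0 < δ → δ < 1 → ∃ (C R₀ T : ℝ) (η : ℝ → ℝ), Tendsto η atTop (𝓝 0) ∧ ∀ (t₁ t₂ : ℝ) (c : ℝ → E3) (R : ℝ → ℝ), T ≤ t₁ → t₁ ≤ t₂ → (∀ s ∈ Set.Icc t₁ t₂, ∀ s' ∈ Set.Icc t₁ t₂, ‖c s - c s'‖ ≤ 2 * |s - s'| ∧ |R s - R s'| ≤ 2 * |s - s'|) → (∀ s ∈ Set.Icc t₁ t₂, (R₀ ≤ R s ∧ ‖c s‖ + R s ≤ (κ + κ ^ 2) / 2 * s ∧ ∀ j, ‖ξ j s - c s‖ ≤ (1 - δ) * R s ∨ (1 + δ) * R s ≤ ‖ξ j s - c s‖)) → ∀ μ : Fin 4, |P t₂ (c t₂) (R t₂) μ - P t₁ (c t₁) (R t₁) μ| ≤ C * (∫ s in t₁..t₂, ((R s) ^ 2)⁻¹ + ((R s) ^ (7 / 4 : ℝ))⁻¹) + η t₁) (hI : ∃ (C R₀ T : ℝ) (ζ : ℝ → ℝ), Tendsto ζ atTop (𝓝 0) ∧ (∀ (t :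 ℝ) (i : Fin N) (R : ℝ), T ≤ t → R₀ ≤ R → ‖ξ i t‖ + R ≤ (κ + κ ^ 2) / 2 * t → (∀ j, j ≠ i → 3 * R ≤ ‖ξ i t - ξ j t‖) → |P t (ξ i t) R 0 - M i * (√(1 - ‖v i t‖ ^ 2))⁻¹| ≤ ζ t + C / R ∧ ∀ k : Fin 3, |P t (ξ i t) R k.succ - M i * (√(1 - ‖v i t‖ ^ 2))⁻¹ * v i t k| ≤ ζ t + C / R) ∧ (∀ (t : ℝ) (c : E3) (R : ℝ) (A : Finset (Fin N)) (ρ : Fin N → ℝ), T ≤ t → R₀ ≤ R → ‖c‖ + R ≤ (κ + κ ^ 2) / 2 * t → (∀ j ∈ A, ‖ξ j t - c‖ ≤ R / 2) → (∀ j ∉ A, 2 * R ≤ ‖ξ j t - c‖) → (∀ j ∈ A, R₀ ≤ ρ j ∧ ρ j ≤ R / 4 ∧ ∀ j', j' ≠ j → 3 * ρ j ≤ ‖ξ j t - ξ j' t‖) → ∀ μ : Fin 4, |P t c R μ - ∑ j ∈ A, P t (ξ j t) (ρ j) μ| ≤ C * (R⁻¹ + ∑ j ∈ A, (ρ j)⁻¹)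 + ζ t)) {i : Fin N} {μ₀ : ℝ} (hμ₀ : 0 < μ₀) (hiso : ∀ j, j ≠ i → ∀ᶠ t in atTop, μ₀ * t ≤ ‖ξ i t - ξ j t‖), ∃ V : E3, Tendsto (v i) atTop (𝓝 V) ∧ Tendsto (fun t : ℝ ↦ t⁻¹ • ξ i t) atTop (𝓝 V) :=
  @ChargeKinematics.tendsto_of_linearly_isolated

end Summit.FinalStateConjecture.FinalStateConjecture.Theorems


namespace Summit.FinalStateConjecture.FinalStateConjecture.Theorems.ChargeKinematics

open Literature.Geometry.Lorentzian

/-! ## Appendix (general `N`): three elementary helpers of the certified-coordinate analysis -/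

section CoordinateHelpers

/-- The normalised vector of a nonzero `r`: unit norm and `⟨u, r⟩ = ‖r‖`. [folklore] -/
theorem unit_smul_facts {r : E3} (hr : r ≠ 0) :
    ‖‖r‖⁻¹ • r‖ = 1 ∧ @inner ℝ E3 _ (‖r‖⁻¹ • r) r = ‖r‖ := by
  have hn : 0 < ‖r‖ := norm_pos_iff.mpr hr
  refine ⟨by rw [norm_smul, norm_inv, norm_norm, inv_mul_cancel₀ hn.ne'], ?_⟩
  rw [real_inner_smul_left, real_inner_self_eq_norm_sq]
  field_simp

/-- `max m₀ |·|` is `1`-Lipschitz: `|max m₀ |x| − max m₀ |y|| ≤ |x − y|`. [folklore] -/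
theorem abs_max_abs_sub_le (m₀ x y : ℝ) : |max m₀ (|x|) - max m₀ (|y|)| ≤ |x - y| := by
  calc |max m₀ (|x|) - max m₀ (|y|)| ≤ max (|m₀ - m₀|) (|(|x|) - (|y|)|) := abs_max_sub_max_le_max _ _ _ _
    _ = |(|x|) - (|y|)| := by simp
    _ ≤ |x - y| := abs_abs_sub_abs_le_abs_sub x y

/-- Vector mean value: `‖(f s' − g s') − (f s − g s)‖ ≤ C (s' − s)` when `‖f' − g'‖ ≤ C` on the interval.
[folklore] -/
theorem norm_sub_sub_le_of_deriv {f g : ℝ → E3} (hf : Differentiable ℝ f) (hg : Differentiable ℝ g)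
    {a b C : ℝ} (hC : ∀ x ∈ Set.Icc a b, ‖deriv f x - deriv g x‖ ≤ C) {s s' : ℝ}
    (hs : s ∈ Set.Icc a b) (hs' : s' ∈ Set.Icc a b) (hss' : s ≤ s') :
    ‖(f s' - g s') - (f s - g s)‖ ≤ C * (s' - s) := by
  have hdiff : ∀ x ∈ Set.Icc a b, DifferentiableAt ℝ (fun t ↦ f t - g t) x := fun x _ ↦ (hf x).sub (hg x)
  have hbound : ∀ x ∈ Set.Icc a b, ‖deriv (fun t ↦ f t - g t) x‖ ≤ C := by
    intro x hx
    rw [deriv_fun_sub (hf x) (hg x)]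
    exact hC x hx
  have := (convex_Icc a b).norm_image_sub_le_of_norm_deriv_le hdiff hbound hs hs'
  rw [Real.norm_eq_abs, abs_of_nonneg (by linarith)] at this
  exact this

end CoordinateHelpers

end Summit.FinalStateConjecture.FinalStateConjecture.Theorems.ChargeKinematics

end
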